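import Literature.NumberTheory.EllipticCurves.OrdinaryNewformDatumAttachedProofs
import Literature.NumberTheory.EllipticCurves.EisensteinNewformLevelRaisingOrdinaryUnitRootProofs
import Literature.FieldTheory.AlgClosed.PadicAlgClEquivComplexCompatible
import HarnessLib

/-!
# The ordinary frame WITH UNIT ROOT of an ordinary newform datum at `p` (Hida 2000 Thm. 3.26 (2) / Wiles 1988 Thm. 2.2 applied to
# the datum, through a complex comparison `ι' : ℚ̄_p ≃ ℂ` compatible with `ι`; proofs only)

Topic `NumberTheory/EllipticCurves` (namespace `Literature.NumberTheory.EllipticCurves.GreenbergSelmer`). THEOREMS ONLY (no definition,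
no named fact; D-0026). For `Δ : OrdinaryNewformDatum g p ι` with `g ∈ S_k(Γ₀(M))` a newform, `k ≥ 2`, `p ∤ M`, `|ι(a_p)|_p = 1`:
choose `ι' : ℚ̄_p ≃+* ℂ` with `ι' ∘ ι = (K_g ⊆ ℂ)` (`exists_padicAlgCl_ringEquiv_complex_apply_eq_of_finiteDimensional`); then
`ι'⁻¹ ∘ (K₁ ⊆ ℂ) = ι|_{K₁}` on the coefficient field `K₁` of the `Γ₁(M)`-lift, `ι'⁻¹(a_p) = ι(a_p)` is a unit, and the named fact
`Hida2000_thm326_ordinary_unitRoot` (GRANTED) applies to `Δ.ρ ⊗ ℚ̄_p` (attached and irreducible: `OrdinaryNewformDatumAttachedProofs`):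

* `OrdinaryNewformDatum.exists_complexCompat` — `ι'` and the conversions (`ι'⁻¹(a_p(g₁)) = ι(a_p(g))`, `ι'⁻¹(ε(p)p^{k−1}) = p^{k−1}`);
* `OrdinaryNewformDatum.exists_ordinaryFrame_unitRoot_of_thm326` — a frame `Q ∈ GL₂(ℚ̄_p)` of `Δ.ρ ⊗ ℚ̄_p` on `Γ_{ℚ_w}` (`w = (p)`):
  `T₁₀ = 0`; `T₁₁ = 1` and `T₀₀ = χ_cyc^{k−1}` on inertia; `T₁₁(Frob) = α`, the unit root of `X² − ι(a_p)X + p^{k−1}`;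
* `OrdinaryNewformDatum.frobRoot_of_ordinaryFrame_of_thm326` — in ANY frame with `T₁₀ = 0`, `T₁₁|_I = 1`, every arithmetic Frobenius has
  `T₁₁(Frob)² − ι(a_p) T₁₁(Frob) + p^{k−1} = 0` (`Hida2000_thm326_ordinary_unitRoot_iff_ordinary_and_frobRoot`).

Use: cell `bsd-stepL`, crux 25505, stub (FIX), memo §1ter rows (a)–(c).

References: [Hida2000] Thm. 3.26 (2); [Wiles1988] Thm. 2.2; [EmertonPollackWeston2006] §3.1.
-/

noncomputable section

open scoped MatrixGroups Matrix ModularForm NumberField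
open NumberField IsDedekindDomain Field CongruenceSubgroup UpperHalfPlane Rat.HeightOneSpectrum Polynomial
open Literature.NumberTheory.GaloisRepresentations Literature.FieldTheory.AlgClosed
open Literature.NumberTheory.EllipticCurves.ModularForms

namespace Literature.NumberTheory.EllipticCurves.GreenbergSelmer

variable {M : ℕ} [NeZero M] {k : ℤ} {g : CuspForm (Gamma0 M) k} {p : ℕ} [Fact p.Prime]
  {ι : coeffField g →+* PadicAlgCl p}

/-- **A complex comparison compatible with `ι`, and the conversions.** For a newform `g ∈ S_k(Γ₀(M))` (`K_g` a number field),
`k ≥ 1`, `p ∤ M`: there is `ι' : ℚ̄_p ≃+* ℂ` with `ι'⁻¹ ∘ (K₁ ⊆ ℂ) = ι|_{K₁}` on the coefficient field of the `Γ₁(M)`-lift `g₁`,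
`ι'⁻¹(a_p(g₁)) = ι(a_p(g))` and `ι'⁻¹(ε_{g₁}(p) p^{k−1}) = p^{k−1}`. [cite: EmertonPollackWeston2006, §3.1 ("fix an embedding ℚ̄ → ℚ̄_p")]
[cite: DiamondShurman2005, §4.3 (S_k(Γ₀(N)) = S_k(N, 𝟙))] -/
theorem exists_complexCompat (hg : IsNewform0 g) (hpM : ¬ p ∣ M) [FiniteDimensional ℚ (coeffField g)] :
    ∃ ι' : PadicAlgCl p ≃+* ℂ,
      (ι'.symm : ℂ →+* PadicAlgCl p).comp (algebraMap (coeffCharField (liftToGamma1 M k g)) ℂ) =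
        ι.comp (IntermediateField.inclusion (coeffCharField_liftToGamma1_le (isNewform0_ne_zero hg))).toRingHom ∧
      ι'.symm ((qExpansion 1 ⇑(liftToGamma1 M k g)).coeff p) = ι ⟨(qExpansion 1 ⇑g).coeff p, coeff_mem_coeffField g p⟩ ∧
      ι'.symm ((nebentypus (liftToGamma1 M k g) (p : ZMod M) : ℂ) * (p : ℂ) ^ (k - 1)) = (p : PadicAlgCl p) ^ (k - 1) := by
  have hp : p.Prime := Fact.out
  have hg0 := isNewform0_ne_zero hg
  have hcoe : (⇑(liftToGamma1 M k g) : ℍ → ℂ) = ⇑g := coe_liftToGamma1_holds M k g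
  have hε : nebentypus (liftToGamma1 M k g) = 1 := nebentypus_liftToGamma1_holds M k hg0
  obtain ⟨ι', hι'⟩ := exists_padicAlgCl_ringEquiv_complex_apply_eq_of_finiteDimensional ι (algebraMap (coeffField g) ℂ)
  have hsymm : ∀ x : coeffField g, ι'.symm ((x : ℂ)) = ι x := fun x ↦ by
    rw [RingEquiv.symm_apply_eq]; exact (hι' x).symm
  refine ⟨ι', RingHom.ext fun y ↦ ?_, ?_, ?_⟩
  · change ι'.symm ((y : ℂ)) = ι (IntermediateField.inclusion (coeffCharField_liftToGamma1_le hg0) y)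
    rw [← hsymm]
    rfl
  · have h1 : (qExpansion 1 ⇑(liftToGamma1 M k g)).coeff p =
        ((⟨(qExpansion 1 ⇑g).coeff p, coeff_mem_coeffField g p⟩ : coeffField g) : ℂ) := by rw [hcoe]
    rw [h1, hsymm]
  · have hunit : IsUnit ((p : ℕ) : ZMod M) :=
      (ZMod.isUnit_iff_coprime p M).mpr ((Nat.Prime.coprime_iff_not_dvd hp).mpr hpM)
    rw [hε, MulChar.one_apply hunit, one_mul, map_zpow₀, map_natCast]

/-- **The ordinary frame with unit root of the datum at `w = (p)`** (GRANTED `Hida2000_thm326_ordinary_unitRoot`): a frame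
`Q ∈ GL₂(ℚ̄_p)` of `Δ.ρ ⊗ ℚ̄_p` restricted to `Γ_{ℚ_w}` with `T₁₀ = 0`, `T₁₁ = 1` and `T₀₀ = χ_cyc^{k−1}` on inertia, and
`T₁₁(σ) = α` at every arithmetic Frobenius `σ`, where `α` is the unit root of `X² − ι(a_p)X + p^{k−1}`.
[cite: Hida2000, Thm. 3.26 (2), p. 152] [cite: Wiles1988, Thm. 2.2] -/
theorem OrdinaryNewformDatum.exists_ordinaryFrame_unitRoot_of_thm326 (hW : Hida2000_thm326_ordinary_unitRoot)
    (Δ : OrdinaryNewformDatum g p ι) (hg : IsNewform0 g) (hk : 2 ≤ k) (hpM : ¬ p ∣ M)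
    (hap : ‖ι ⟨(qExpansion 1 ⇑g).coeff p, coeff_mem_coeffField g p⟩‖ = 1)
    [FiniteDimensional ℚ (coeffField g)] [FiniteDimensional ℚ_[p] (padicCoeffField ι)]
    {w : HeightOneSpectrum (𝓞 ℚ)} (hw : (p : 𝓞 ℚ) ∈ w.asIdeal) :
    ∃ (Q : GL (Fin 2) (PadicAlgCl p)) (α : PadicAlgCl p), Valued.v α = 1 ∧
      α ^ 2 - ι ⟨(qExpansion 1 ⇑g).coeff p, coeff_mem_coeffField g p⟩ * α + (p : PadicAlgCl p) ^ (k - 1) = 0 ∧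
      ∀ σ : absoluteGaloisGroup (w.adicCompletion ℚ),
        (Q⁻¹ * FramedGaloisRep.toLocal w (FramedRep.baseChange (padicCoeffIntegers.toPadicAlgCl ι) continuous_toPadicAlgCl Δ.ρ) σ * Q).val 1 0 = 0 ∧
        (σ ∈ absInertia (w.adicCompletion ℚ) →
          (Q⁻¹ * FramedGaloisRep.toLocal w (FramedRep.baseChange (padicCoeffIntegers.toPadicAlgCl ι) continuous_toPadicAlgCl Δ.ρ) σ * Q).val 1 1 = 1 ∧
          (Q⁻¹ * FramedGaloisRep.toLocal w (FramedRep.baseChange (padicCoeffIntegers.toPadicAlgCl ι) continuous_toPadicAlgCl Δ.ρ) σ * Q).val 0 0 =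
            algebraMap ℚ_[p] (PadicAlgCl p)
              (((GaloisRep.cyclotomicCharacter (w.adicCompletion ℚ) p σ).val : ℤ_[p]) : ℚ_[p]) ^ (k - 1)) ∧
        (IsAbsArithFrob σ →
          (Q⁻¹ * FramedGaloisRep.toLocal w (FramedRep.baseChange (padicCoeffIntegers.toPadicAlgCl ι) continuous_toPadicAlgCl Δ.ρ) σ * Q).val 1 1 = α) := by
  have hg1 : IsNewform1 (liftToGamma1 M k g) := (isNewform1_liftToGamma1_iff_holds M k g).mpr hg
  obtain ⟨ι', hj, hap', hconst⟩ := exists_complexCompat (k := k) hg hpM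
  have hv1 : Valued.v (ι'.symm ((qExpansion 1 ⇑(liftToGamma1 M k g)).coeff p)) = 1 := by
    rw [hap', PadicAlgCl.valuation_def, ← NNReal.coe_inj, coe_nnnorm, NNReal.coe_one]
    exact hap
  have hρ := Δ.isGaloisRepOfNewform1_baseChange_padicAlgCl hg (by omega : 1 ≤ k)
  rw [← hj] at hρ
  have hirr := Δ.isIrreducible_baseChange_padicAlgCl hg (by omega : 1 ≤ k)
  obtain ⟨Q, α, hα1, hαroot, hT⟩ := hW (liftToGamma1 M k g) hk hg1 p ι' hpM hv1 _ hρ hirr w hw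
  refine ⟨Q, α, hα1, ?_, hT⟩
  rw [hap', hconst] at hαroot
  exact hαroot

/-- **In ANY ordinary frame of the datum, Frobenius acts on the unramified quotient by a root of `X² − ι(a_p)X + p^{k−1}`** (GRANTED
`Hida2000_thm326_ordinary_unitRoot`; the quotient character does not depend on the frame, `apply_one_one_eq_of_ordinaryFrames`).
[cite: Hida2000, Thm. 3.26 (2), p. 152] [cite: Wiles1988, Thm. 2.2] -/
theorem OrdinaryNewformDatum.frobRoot_of_ordinaryFrame_of_thm326 (hW : Hida2000_thm326_ordinary_unitRoot)
    (Δ : OrdinaryNewformDatum g p ι) (hg : IsNewform0 g) (hk : 2 ≤ k) (hpM : ¬ p ∣ M)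
    (hap : ‖ι ⟨(qExpansion 1 ⇑g).coeff p, coeff_mem_coeffField g p⟩‖ = 1)
    [FiniteDimensional ℚ (coeffField g)] [FiniteDimensional ℚ_[p] (padicCoeffField ι)]
    {w : HeightOneSpectrum (𝓞 ℚ)} (hw : (p : 𝓞 ℚ) ∈ w.asIdeal) (Q : GL (Fin 2) (PadicAlgCl p))
    (hQ : ∀ σ : absoluteGaloisGroup (w.adicCompletion ℚ),
      (Q⁻¹ * FramedGaloisRep.toLocal w (FramedRep.baseChange (padicCoeffIntegers.toPadicAlgCl ι) continuous_toPadicAlgCl Δ.ρ) σ * Q).val 1 0 = 0 ∧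
      (σ ∈ absInertia (w.adicCompletion ℚ) →
        (Q⁻¹ * FramedGaloisRep.toLocal w (FramedRep.baseChange (padicCoeffIntegers.toPadicAlgCl ι) continuous_toPadicAlgCl Δ.ρ) σ * Q).val 1 1 = 1))
    {σ : absoluteGaloisGroup (w.adicCompletion ℚ)} (hσ : IsAbsArithFrob σ) :
    (Q⁻¹ * FramedGaloisRep.toLocal w (FramedRep.baseChange (padicCoeffIntegers.toPadicAlgCl ι) continuous_toPadicAlgCl Δ.ρ) σ * Q).val 1 1 ^ 2 -
        ι ⟨(qExpansion 1 ⇑g).coeff p, coeff_mem_coeffField g p⟩ *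
          (Q⁻¹ * FramedGaloisRep.toLocal w (FramedRep.baseChange (padicCoeffIntegers.toPadicAlgCl ι) continuous_toPadicAlgCl Δ.ρ) σ * Q).val 1 1 +
      (p : PadicAlgCl p) ^ (k - 1) = 0 := by
  have hg1 : IsNewform1 (liftToGamma1 M k g) := (isNewform1_liftToGamma1_iff_holds M k g).mpr hg
  obtain ⟨ι', hj, hap', hconst⟩ := exists_complexCompat (k := k) hg hpM
  have hv1 : Valued.v (ι'.symm ((qExpansion 1 ⇑(liftToGamma1 M k g)).coeff p)) = 1 := by
    rw [hap', PadicAlgCl.valuation_def, ← NNReal.coe_inj, coe_nnnorm, NNReal.coe_one]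
    exact hap
  have hρ := Δ.isGaloisRepOfNewform1_baseChange_padicAlgCl hg (by omega : 1 ≤ k)
  rw [← hj] at hρ
  have hirr := Δ.isIrreducible_baseChange_padicAlgCl hg (by omega : 1 ≤ k)
  have h := (Hida2000_thm326_ordinary_unitRoot_iff_ordinary_and_frobRoot.mp hW).2 (liftToGamma1 M k g) hk hg1 p ι'
    hpM hv1 _ hρ hirr w hw Q hQ σ hσ
  rw [hap', hconst] at h
  exact h

end Literature.NumberTheory.EllipticCurves.GreenbergSelmer

end
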